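import Mathlib.RingTheory.TensorProduct.Free
import Mathlib.LinearAlgebra.FreeModule.Finite.Basic
import Mathlib.LinearAlgebra.Dual.Defs
import Mathlib.LinearAlgebra.TensorProduct.Tower
import Mathlib.RingTheory.Ideal.Maps
import Mathlib.Algebra.Algebra.Bilinear
import Mathlib.Algebra.GroupWithZero.NonZeroDivisors
import HarnessLib

/-!
# Route `RamifiedHeegnerPair`, crux U₁ `LeafRankOneUpperAtThree` (stmt-BirchSwinnertonDyer-26022), line `partnerdescent` —
# partner kernel, algebra brick (F6a): a free lattice is cut out by its dual functionals

HONEST FRAMING. Theorems only; helper file (`--supports stmt-BirchSwinnertonDyer-26022 --as helper`); pure commutative algebra over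
Mathlib, no number theory, no named fact, no `sorry`; nothing booked; BSD is proved for no curve. Lead prover bsd-line-rhp-p2 g60, 2026-08-31.

WHY. The line's stub (G3♭ˢ) `Partnerdescent.stub_partnerCokernelThreeFreeFlatSplit` is DERIVATION-grade: the lead's pen-agreed derivation
(`Cruxes/LeafRankOneUpperAtThree/LEAD-G56-G3-NONSCALAR.md`) uses, besides five printed inputs (F1)–(F5),(F7) on character groups and Hecke
algebras (untyped), an elementary commutative-algebra package (F6). Its item (F6a) — «for a reduced `ℤ₃`-order `R` with canonical module
`ω_R = Hom(R, ℤ₃)`, the elements `t ∈ R ⊗ ℚ` with `t·ω_R ⊂ ω_R` are exactly `R`» — reduces (taking `x = 1` in `(t·φ)(x) = φ(tx)`) to the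
double-duality statement typed and PROVED here in Mathlib generality: an element of `K ⊗_O R` (`R` a finite free `O`-module, `K` any
commutative `O`-algebra, e.g. `Frac O`) on which EVERY base-changed `O`-linear functional of `R` takes a value in `O` lies in `R`.
The memo LEAD-G56-G3-NONSCALAR.md §1 (F6a) is a tree document, not print; the statement itself is textbook linear algebra (dual bases
and extension of scalars). [cite: BourbakiAlgebraI1989, Ch. II §2 no. 6 (dual basis) and Ch. II §5 no. 1 (extension of scalars)]

* `LeafPartnerOrders.exists_tmul_eq_of_forall_dual_baseChange` — (F6a) core: `t ∈ 1 ⊗ R` as soon as `φ_K(t) ∈ O` for every `φ ∈ R^∨`.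
-/

set_option linter.dupNamespace false
set_option autoImplicit false

noncomputable section

open scoped TensorProduct

namespace Summit.BirchSwinnertonDyer.BirchSwinnertonDyer.Theorems.LeafPartnerOrders

variable {O : Type*} [CommRing O] {K : Type*} [CommRing K] [Algebra O K]
  {R : Type*} [AddCommGroup R] [Module O R] [Module.Free O R] [Module.Finite O R]

/-- **(F6a) A finite free lattice is cut out by its dual functionals.** Let `R` be a finite free `O`-module and `K` a commutative
`O`-algebra. If `t ∈ K ⊗_O R` is such that for EVERY `O`-linear functional `φ : R → O` the base-changed functional
`φ_K : K ⊗_O R → K ⊗_O O ≅ K` takes on `t` a value in the image of `O`, then `t = 1 ⊗ x` for some `x ∈ R`. (Dual-basis argument: the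
coordinates of `t` in the `K`-basis `1 ⊗ bᵢ` are the values `(b.coord i)_K(t)`.) In the (G3♭ˢ) derivation this is the step
«`{t ∈ 𝕋′ ⊗ ℚ : t·ω ⊂ ω} = 𝕋′_𝔪`» read at `x = 1`. [cite: BourbakiAlgebraI1989, Ch. II §2 no. 6 and Ch. II §5 no. 1] -/
theorem exists_tmul_eq_of_forall_dual_baseChange (t : K ⊗[O] R)
    (ht : ∀ φ : Module.Dual O R,
      (TensorProduct.AlgebraTensorModule.rid O K K) (φ.baseChange K t) ∈ Set.range (algebraMap O K)) :
    ∃ x : R, (1 : K) ⊗ₜ[O] x = t := by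
  classical
  let b := Module.Free.chooseBasis O R
  let bK := Algebra.TensorProduct.basis K b
  -- the coordinates of any `s` in the `K`-basis `1 ⊗ bᵢ` are the values of the base-changed coordinate functionals
  have hcoord : ∀ (i) (s : K ⊗[O] R), bK.repr s i =
      (TensorProduct.AlgebraTensorModule.rid O K K) ((b.coord i).baseChange K s) := by
    intro i s
    induction s using TensorProduct.induction_on with
    | zero => simp
    | tmul a m =>
        simp only [bK, Algebra.TensorProduct.basis_repr_tmul, LinearMap.baseChange_tmul,
          TensorProduct.AlgebraTensorModule.rid_tmul, Module.Basis.coord_apply, Algebra.smul_def]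
        rw [Finsupp.smul_apply, Finsupp.mapRange_apply, smul_eq_mul, mul_comm]
    | add x y hx hy => simp only [map_add, Finsupp.add_apply, hx, hy]
  -- each coordinate of `t` lies in `O`
  have hO : ∀ i, ∃ a : O, algebraMap O K a = bK.repr t i := fun i ↦ by
    obtain ⟨a, ha⟩ := ht (b.coord i)
    exact ⟨a, by rw [hcoord i t]; exact ha⟩
  choose a ha using hO
  refine ⟨∑ i, a i • b i, ?_⟩
  -- `1 ⊗ (∑ aᵢ bᵢ) = ∑ (algebraMap aᵢ) • (1 ⊗ bᵢ) = ∑ (repr t i) • bK i = t`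
  calc (1 : K) ⊗ₜ[O] (∑ i, a i • b i)
      = ∑ i, algebraMap O K (a i) • bK i := by
        rw [TensorProduct.tmul_sum]
        refine Finset.sum_congr rfl fun i _ ↦ ?_
        rw [TensorProduct.tmul_smul, Algebra.TensorProduct.basis_apply]
        exact (algebraMap_smul K (a i) _).symm
    _ = ∑ i, bK.repr t i • bK i := by simp_rw [ha]
    _ = t := bK.sum_repr t

/-! ## (F6b), (F6c) — appended by the same seat (lead g60): Gorenstein duality for an ideal, new/old annihilators

(F6b) In the derivation's Step 2, `𝕋_B` is Gorenstein: there is an `O`-linear "trace" `λ` on it whose pairing `(a, t) ↦ λ(at)` is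
perfect (`a ↦ λ(a·)` is a bijection `𝕋_B → 𝕋_B^∨`). For an ideal `J`, the functionals on `𝕋_B/J` are the functionals on `𝕋_B` vanishing
on `J`, and `a ↦ λ(a·)` restricts to a bijection `Ann(J) ≃ (𝕋_B/J)^∨ = ω_{𝕋_B/J}` (`𝕋_B`-linear by construction): the two theorems below
are its two halves. (F6c) For `R ↪ A₁ × A₂` (jointly injective ring maps `π₁, π₂`; in the derivation `A₁ = K_new`, `A₂ = K_old`) with ONE
element of `ker π₁` mapping to a non-zero-divisor of `A₂` (full rank), `Ann_R(ker π₁) = ker π₂` — i.e. `I = Ann_R(J)` for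
`I = R ∩ (A₁ × 0)`, `J = R ∩ (0 × A₂)`. Both are textbook commutative algebra; stated and PROVED in Mathlib generality.
[cite: BourbakiAlgebraI1989, Ch. II §2 no. 6 (dual basis, orthogonality)] -/

section Gorenstein

variable {O' : Type*} [CommRing O'] {R' : Type*} [CommRing R'] [Algebra O' R']

/-- **(F6b) Gorenstein duality for an ideal.** If the `O`-linear functional `λ` on the commutative `O`-algebra `R` is a PERFECT trace
(`a ↦ λ(a·)` is a bijection `R → R^∨`, i.e. `R ≅ ω_R`), then for every ideal `J ⊆ R` each `O`-functional `ψ` on `R` vanishing on `J`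
(= a functional on `R/J`) is `λ(a·)` for a UNIQUE `a ∈ R`, and that `a` annihilates `J`. With the easy converse
`dual_mulLeft_apply_eq_zero_of_mem_annihilator` this is the bijection `Ann_R(J) ≃ (R/J)^∨ = ω_{R/J}` of the (G3♭ˢ) derivation's Step 2
(LEAD-G56-G3-NONSCALAR.md §1 (F6b)). [cite: BourbakiAlgebraI1989, Ch. II §2 no. 6] -/
theorem existsUnique_mem_annihilator_dual_mulLeft_eq (lam : Module.Dual O' R')
    (hperf : Function.Bijective fun a : R' ↦ lam ∘ₗ LinearMap.mulLeft O' a)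
    (J : Ideal R') (ψ : Module.Dual O' R') (hψ : ∀ j ∈ J, ψ j = 0) :
    ∃! a : R', a ∈ J.annihilator ∧ lam ∘ₗ LinearMap.mulLeft O' a = ψ := by
  obtain ⟨a, ha⟩ := hperf.2 ψ
  refine ⟨a, ⟨?_, ha⟩, fun b hb ↦ hperf.1 (hb.2.trans ha.symm)⟩
  -- `a` kills `J`: `λ((a j) t) = ψ(j t) = 0` for all `t`, so `λ((a j)·) = λ(0·)` and `a j = 0` by injectivity
  rw [Submodule.mem_annihilator]
  intro j hj
  apply hperf.1
  ext t
  have h1 : (lam ∘ₗ LinearMap.mulLeft O' (a • j)) t = ψ (j * t) := by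
    have := congrArg (fun f : Module.Dual O' R' ↦ f (j * t)) ha
    simpa [LinearMap.mulLeft_apply, smul_eq_mul, mul_assoc] using this
  rw [h1, hψ _ (J.mul_mem_right t hj)]
  simp

/-- **(F6b), the easy half**: `λ(a·)` vanishes on `J` when `a ∈ Ann_R(J)`. [cite: BourbakiAlgebraI1989, Ch. II §2 no. 6] -/
theorem dual_mulLeft_apply_eq_zero_of_mem_annihilator (lam : Module.Dual O' R') (J : Ideal R') {a : R'}
    (ha : a ∈ J.annihilator) : ∀ j ∈ J, (lam ∘ₗ LinearMap.mulLeft O' a) j = 0 := by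
  intro j hj
  rw [Submodule.mem_annihilator] at ha
  simp [LinearMap.mulLeft_apply, ← smul_eq_mul, ha j hj]

end Gorenstein

section NewOld

variable {R' : Type*} [CommRing R'] {A₁ A₂ : Type*} [CommRing A₁] [CommRing A₂]

/-- **(F6c) new/old annihilators.** For a commutative ring `R` with two ring maps `π₁ : R → A₁`, `π₂ : R → A₂` that are JOINTLY injective
(`R ↪ A₁ × A₂`), if some `j₀ ∈ ker π₁` maps to a non-zero-divisor of `A₂` (in the derivation: `R = 𝕋_B` has full rank in
`K_new × K_old`, so `(0, n) ∈ R` for some `n ≠ 0`), then `Ann_R(ker π₁) = ker π₂` — with `I = ker π₂ = R ∩ (A₁ × 0)` and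
`J = ker π₁ = R ∩ (0 × A₂)` this is `I = Ann_R(J)` (LEAD-G56-G3-NONSCALAR.md §1 (F6c)). [cite: BourbakiAlgebraI1989, Ch. I §8 no. 7 (ideals in a product)] -/
theorem annihilator_ker_eq_ker_of_mem_nonZeroDivisors (π₁ : R' →+* A₁) (π₂ : R' →+* A₂)
    (hinj : ∀ t : R', π₁ t = 0 → π₂ t = 0 → t = 0)
    (j₀ : R') (hj₀ : π₁ j₀ = 0) (hj₀' : π₂ j₀ ∈ nonZeroDivisors A₂) :
    (RingHom.ker π₁).annihilator = RingHom.ker π₂ := by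
  ext t
  rw [Submodule.mem_annihilator, RingHom.mem_ker]
  constructor
  · intro h
    have h0 : t * j₀ = 0 := by simpa [smul_eq_mul] using h j₀ (by rwa [RingHom.mem_ker])
    have : π₂ t * π₂ j₀ = 0 := by rw [← map_mul, h0, map_zero]
    exact (mul_right_mem_nonZeroDivisors_eq_zero_iff hj₀').mp this
  · intro ht j hj
    rw [RingHom.mem_ker] at hj
    apply hinj
    · rw [smul_eq_mul, map_mul, hj, mul_zero]
    · rw [smul_eq_mul, map_mul, ht, zero_mul]

end NewOld

end Summit.BirchSwinnertonDyer.BirchSwinnertonDyer.Theorems.LeafPartnerOrders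

end
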